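import Literature.LinearAlgebra.QuadraticForm.CartanDieudonne
import Mathlib.LinearAlgebra.Determinant
import Mathlib.LinearAlgebra.Projection
import Mathlib.FieldTheory.IsAlgClosed.Basic
import Mathlib.Algebra.Polynomial.Roots
import HarnessLib

/-!
# Special orthogonal transformations supported on a nondegenerate subspace are products of hyperbolic rotations

Generic linear algebra for the integration step ("a tensor killed by `𝔰𝔬` is fixed by `SO`") of
the tree's elementary proof of Zarhin's theorem on the Hodge group of a Hodge structure of K3 type
(Huybrechts, *Lectures on K3 Surfaces*, Thm. 3.3.9: `Hdg(T) = SO(T, Ψ)` for `E = End_Hdg(T)` totally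
real; there an element `g ∈ SO(T, Ψ)(E)` acts on `V_ℂ = ⊕_σ V_σ` through `g_σ ∈ SO(V_σ)` and the
identity on the other summands). Over a field `K` with `2 ≠ 0`, for a nondegenerate symmetric
bilinear form `B` on a finite-dimensional `V`:

* `exists_eq_prod_reflections_of_forall_mem_orthogonal` — Cartan–Dieudonné RELATIVE to a
  nondegenerate subspace `U`: a `B`-orthogonal `σ` which is the identity on `U^⊥` is a product of
  reflections along non-isotropic vectors OF `U` (from the tree's absolute version
  `Literature.LinearAlgebra.QuadraticForm.exists_eq_prod_reflections`, Iversen, *Hyperbolic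
  Geometry*, I §2, applied to `σ|_U` and `B|_U`);
* `det_reflection`: `det τ_n = -1`, hence a special orthogonal `σ` is a product of an EVEN number of
  reflections (`even_length_of_det_eq_one`);
* hyperbolic pairs and rotations: in a nondegenerate plane over an algebraically closed field there
  is a hyperbolic pair `e, f` (`B(e,e) = B(f,f) = 0`, `B(e,f) = 1`; `exists_hyperbolic_pair`), the
  product of two reflections along non-isotropic vectors of the plane is the **hyperbolic rotation**
  `rotation B e f z : e ↦ z e, f ↦ z⁻¹ f, x ↦ x (x ⊥ e, f)` (`reflection_mul_reflection_eq_rotation`),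
  whose "logarithm" is the `B`-antisymmetric `rotationGenerator B e f : e ↦ e, f ↦ -f, x ↦ 0`;
* `exists_forall_planeDiscr_ne_zero`: a "generic pivot" — a non-isotropic `p ∈ U` spanning a
  nondegenerate plane with each of finitely many given non-isotropic vectors (a finite union of
  proper quadrics does not cover `U`; needs `K` infinite and `dim U ≥ 2`), used to rewrite
  `τ_a τ_b = (τ_a τ_p)(τ_p τ_b)` with both planes nondegenerate;
* **main theorem** `exists_eq_prod_rotations`: over an algebraically closed field of characteristic
  `≠ 2`, a `B`-orthogonal `σ` of determinant `1` which is the identity on `U^⊥` (`U` nondegenerate,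
  `dim U ≥ 2`) is a product of hyperbolic rotations `rotation B eᵢ fᵢ zᵢ` with hyperbolic pairs
  `eᵢ, fᵢ ∈ U` (E. Artin, *Geometric Algebra*, Ch. III §3–4 and Thm. 3.20; this is the classical
  statement "`SO` is generated by the rotations in nondegenerate planes", in a form carrying the
  support `U`).

No named facts are introduced; the only definitions are `rotation`, `rotationGenerator` and
`planeDiscr` (the Gram determinant of two vectors).

## References

* E. Artin, *Geometric Algebra*, Interscience (1957), Ch. III, §3–4, Thm. 3.20.
* B. Iversen, *Hyperbolic Geometry*, CUP (1992), Ch. I §2 (reflections, generation).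
* D. Huybrechts, *Lectures on K3 Surfaces*, CUP (2016), Thm. 3.3.9.
-/

noncomputable section

namespace Literature.AlgebraicGeometry.Motives

namespace OrthogonalGeneration

open Literature.LinearAlgebra.QuadraticForm

universe u v

variable {K : Type u} [Field K] {V : Type v} [AddCommGroup V] [Module K V]

/-! ### Cartan–Dieudonné relative to a nondegenerate subspace -/

/-- An orthogonal transformation which is the identity on `U^⊥` maps `U` into `U`
(`U = U^⊥⊥` for a nondegenerate symmetric form on a finite-dimensional space). [folklore] -/
theorem apply_mem_of_forall_mem_orthogonal [FiniteDimensional K V] {B : LinearMap.BilinForm K V}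
    (hB : B.IsSymm) (hBn : B.Nondegenerate) {U : Submodule K V} {σ : Module.End K V}
    (hσ : B.IsOrthogonal σ) (hfix : ∀ w ∈ B.orthogonal U, σ w = w) {x : V} (hx : x ∈ U) :
    σ x ∈ U := by
  rw [← LinearMap.BilinForm.orthogonal_orthogonal hBn hB.isRefl U,
    LinearMap.BilinForm.mem_orthogonal_iff]
  intro w hw
  rw [← hfix w hw, hσ, hB.eq w x]
  exact (LinearMap.BilinForm.mem_orthogonal_iff.1 hw) x hx

/-- **Cartan–Dieudonné relative to a nondegenerate subspace.** For a nondegenerate symmetric `B`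
(`2 ≠ 0` in `K`), a subspace `U` with `B|_U` nondegenerate and a `B`-orthogonal `σ` which is the
identity on `U^⊥`: `σ = τ_{n₁} ⋯ τ_{n_r}` with non-isotropic `nᵢ ∈ U` (apply the absolute theorem
`exists_eq_prod_reflections` to `σ|_U`, extend the reflections of `U` to `V`, and compare on
`V = U ⊕ U^⊥`). [cite: Iversen1992, Ch. I §2, paragraph after Thm. 2.4] -/
theorem exists_eq_prod_reflections_of_forall_mem_orthogonal [NeZero (2 : K)] [FiniteDimensional K V]
    {B : LinearMap.BilinForm K V} (hB : B.IsSymm) (hBn : B.Nondegenerate) (U : Submodule K V)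
    (hU : (B.restrict U).Nondegenerate) (σ : Module.End K V) (hσ : B.IsOrthogonal σ)
    (hfix : ∀ w ∈ B.orthogonal U, σ w = w) :
    ∃ l : List V, (∀ n ∈ l, n ∈ U ∧ B n n ≠ 0) ∧ σ = (l.map (reflection B)).prod := by
  have hmaps : ∀ x ∈ U, σ x ∈ U := fun x hx => apply_mem_of_forall_mem_orthogonal hB hBn hσ hfix hx
  set σU : Module.End K U := σ.restrict hmaps with hσU
  have hBU : (B.restrict U).IsSymm := ⟨fun x y => hB.eq x y⟩
  have hσU_orth : (B.restrict U).IsOrthogonal σU := fun x y => hσ x y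
  obtain ⟨l, hl, -, hprod⟩ := exists_eq_prod_reflections hBU hU σU hσU_orth
  refine ⟨l.map Subtype.val, fun n hn => ?_, ?_⟩
  · obtain ⟨m, hm, rfl⟩ := List.mem_map.1 hn
    exact ⟨m.2, hl m hm⟩
  -- compare `σ` and the ambient word on `U` and on `U^⊥`
  have hcompl : IsCompl U (B.orthogonal U) :=
    LinearMap.BilinForm.isCompl_orthogonal_of_restrict_nondegenerate hB.isRefl hU
  have honU : ∀ u : U, σ u = ((l.map Subtype.val).map (reflection B)).prod (u : V) := by
    intro u
    have h1 : (σ u : V) = ((σU u : U) : V) := by rw [hσU, LinearMap.coe_restrict_apply]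
    rw [h1, hprod, coe_prod_reflections_restrict, List.map_map]
    rfl
  have honW : ∀ w ∈ B.orthogonal U, ((l.map Subtype.val).map (reflection B)).prod w = w := by
    intro w hw
    refine prod_reflections_apply_of_forall_ortho fun n hn => ?_
    obtain ⟨m, -, rfl⟩ := List.mem_map.1 hn
    exact (LinearMap.BilinForm.mem_orthogonal_iff.1 hw) m m.2
  ext x
  obtain ⟨u, hu, w, hw, rfl⟩ := Submodule.mem_sup.1 (hcompl.sup_eq_top.symm ▸ Submodule.mem_top :
    x ∈ U ⊔ B.orthogonal U)
  rw [map_add, map_add, hfix w hw, honW w hw, ← Subtype.coe_mk u hu, honU ⟨u, hu⟩]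

/-! ### The determinant of a reflection; parity -/

/-- **`det τ_n = -1`** for a non-isotropic `n` (`τ_n = -1` on `K n` and `= 1` on `n^⊥`,
`V = K n ⊕ n^⊥`). [folklore] -/
theorem det_reflection [FiniteDimensional K V] (B : LinearMap.BilinForm K V) {n : V}
    (hn : B n n ≠ 0) : LinearMap.det (reflection B n) = -1 := by
  classical
  have hn0 : n ≠ 0 := fun h => hn (by simp [h])
  set p : Submodule K V := K ∙ n with hp
  set q : Submodule K V := B.orthogonal (K ∙ n) with hq
  have hc : IsCompl p q := LinearMap.BilinForm.isCompl_span_singleton_orthogonal hn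
  set e := Submodule.prodEquivOfIsCompl p q hc with he
  -- `τ_n = e ∘ ((-1) × 1) ∘ e⁻¹`
  have key : reflection B n =
      (e : (p × q) →ₗ[K] V) ∘ₗ ((-LinearMap.id : p →ₗ[K] p).prodMap (LinearMap.id : q →ₗ[K] q)) ∘ₗ
        (e.symm : V →ₗ[K] (p × q)) := by
    refine LinearMap.ext fun x => ?_
    obtain ⟨y, rfl⟩ := e.surjective x
    simp only [LinearMap.coe_comp, LinearEquiv.coe_coe, Function.comp_apply,
      LinearEquiv.symm_apply_apply, LinearMap.prodMap_apply, LinearMap.neg_apply,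
      LinearMap.id_apply]
    rw [he, Submodule.coe_prodEquivOfIsCompl', Submodule.coe_prodEquivOfIsCompl', map_add]
    congr 1
    · obtain ⟨c, hc'⟩ := Submodule.mem_span_singleton.1 y.1.2
      rw [Submodule.coe_neg, ← hc', map_smul, reflection_apply_self B hn, smul_neg]
    · exact reflection_apply_of_ortho B
        ((LinearMap.BilinForm.mem_orthogonal_iff.1 y.2.2) n (Submodule.mem_span_singleton_self n))
  rw [key, LinearMap.det_conj ((-LinearMap.id : p →ₗ[K] p).prodMap (LinearMap.id : q →ₗ[K] q)) e,
    LinearMap.det_prodMap, LinearMap.det_id, mul_one, show (-LinearMap.id : p →ₗ[K] p) =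
      (-1 : K) • (LinearMap.id : p →ₗ[K] p) from (neg_one_smul K _).symm, LinearMap.det_smul,
    LinearMap.det_id, mul_one, hp, finrank_span_singleton hn0, pow_one]

/-- The determinant of a word in reflections along non-isotropic vectors is `(-1)^{length}`.
[folklore] -/
theorem det_prod_reflections [FiniteDimensional K V] (B : LinearMap.BilinForm K V) {l : List V}
    (hl : ∀ n ∈ l, B n n ≠ 0) :
    LinearMap.det ((l.map (reflection B)).prod) = (-1) ^ l.length := by
  induction l with
  | nil => simp
  | cons n l ih =>
    rw [List.map_cons, List.prod_cons, map_mul, det_reflection B (hl n List.mem_cons_self),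
      ih (fun m hm => hl m (List.mem_cons_of_mem n hm)), List.length_cons, pow_succ, mul_comm]

/-- **Parity**: a word in reflections along non-isotropic vectors with determinant `1` has even
length (`2 ≠ 0` in `K`). [folklore] -/
theorem even_length_of_det_eq_one [NeZero (2 : K)] [FiniteDimensional K V]
    (B : LinearMap.BilinForm K V) {l : List V} (hl : ∀ n ∈ l, B n n ≠ 0)
    (hdet : LinearMap.det ((l.map (reflection B)).prod) = 1) : Even l.length := by
  rw [det_prod_reflections B hl] at hdet
  refine (neg_one_pow_eq_one_iff_even ?_).1 hdet
  intro h
  have : (2 : K) = 0 := by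
    have h' : (-1 : K) + 1 = 1 + 1 := by rw [h]
    rw [neg_add_cancel] at h'
    rw [show (2 : K) = 1 + 1 by norm_num, ← h']
  exact NeZero.ne (2 : K) this

/-- **Pairing an even word**: a word of even length in the letters `τ` is a word in the products
`τ a τ b` of consecutive letters. [folklore] -/
theorem exists_pairs_prod_eq {M : Type*} [Monoid M] {α : Type*} (τ : α → M) :
    ∀ l : List α, Even l.length →
      ∃ P : List (α × α), (∀ q ∈ P, q.1 ∈ l ∧ q.2 ∈ l) ∧
        (l.map τ).prod = (P.map fun q => τ q.1 * τ q.2).prod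
  | [], _ => ⟨[], by simp, by simp⟩
  | [a], h => by simp at h
  | a :: b :: l, h => by
    have h' : Even l.length := by
      simp only [List.length_cons] at h
      rw [Nat.even_add_one, Nat.even_add_one, not_not] at h
      exact h
    obtain ⟨P, hP, hprod⟩ := exists_pairs_prod_eq τ l h'
    refine ⟨(a, b) :: P, ?_, ?_⟩
    · intro q hq
      rcases List.mem_cons.1 hq with rfl | hq
      · exact ⟨List.mem_cons_self, List.mem_cons_of_mem _ List.mem_cons_self⟩
      · exact ⟨List.mem_cons_of_mem _ (List.mem_cons_of_mem _ (hP q hq).1),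
          List.mem_cons_of_mem _ (List.mem_cons_of_mem _ (hP q hq).2)⟩
    · rw [List.map_cons, List.map_cons, List.prod_cons, List.prod_cons, hprod, List.map_cons,
        List.prod_cons, mul_assoc]

/-! ### Hyperbolic pairs, rotations and their generators -/

/-- The **Gram determinant** (plane discriminant) `B(a,a) B(b,b) - B(a,b)²` of two vectors: it is
non-zero iff `a, b` span a plane on which the symmetric form `B` is nondegenerate. [folklore] -/
def planeDiscr (B : LinearMap.BilinForm K V) (a b : V) : K :=
  B a a * B b b - B a b * B a b

/-- The plane discriminant is symmetric (for symmetric `B`). [folklore] -/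
theorem planeDiscr_comm {B : LinearMap.BilinForm K V} (hB : B.IsSymm) (a b : V) :
    planeDiscr B a b = planeDiscr B b a := by
  rw [planeDiscr, planeDiscr, hB.eq a b]
  ring

/-- The **hyperbolic rotation** attached to a hyperbolic pair `e, f` (`B(e,e) = B(f,f) = 0`,
`B(e,f) = 1`) and a unit `z`: `e ↦ z e`, `f ↦ z⁻¹ f`, and the identity on `{e, f}^⊥` — the general
element of `SO` of the hyperbolic plane `K e ⊕ K f` (E. Artin, *Geometric Algebra*, Ch. III §4),
extended by the identity. As a formula: `x ↦ x + (z - 1) B(f,x) e + (z⁻¹ - 1) B(e,x) f`. [folklore] -/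
def rotation (B : LinearMap.BilinForm K V) (e f : V) (z : K) : Module.End K V :=
  1 + (z - 1) • (B f).smulRight e + (z⁻¹ - 1) • (B e).smulRight f

/-- The **infinitesimal generator** of the hyperbolic rotations in the pair `e, f`:
`e ↦ e`, `f ↦ -f`, `{e,f}^⊥ ↦ 0`, i.e. `x ↦ B(f,x) e - B(e,x) f`; it is `B`-antisymmetric, and the
rotation `rotation B e f z` acts on its eigenspaces (eigenvalues `1, -1, 0`) by `z, z⁻¹, 1`.
[folklore] -/
def rotationGenerator (B : LinearMap.BilinForm K V) (e f : V) : Module.End K V :=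
  (B f).smulRight e - (B e).smulRight f

/-- The rotation as a formula. [folklore] -/
theorem rotation_apply (B : LinearMap.BilinForm K V) (e f : V) (z : K) (x : V) :
    rotation B e f z x = x + ((z - 1) * B f x) • e + ((z⁻¹ - 1) * B e x) • f := by
  simp [rotation, mul_smul, add_assoc]

/-- The generator as a formula. [folklore] -/
theorem rotationGenerator_apply (B : LinearMap.BilinForm K V) (e f x : V) :
    rotationGenerator B e f x = B f x • e - B e x • f := by
  simp [rotationGenerator]

section HyperbolicPair

variable {B : LinearMap.BilinForm K V} {e f : V}

/-- `rotation B e f z e = z e`. [folklore] -/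
theorem rotation_apply_left (hB : B.IsSymm) (he : B e e = 0) (hef : B e f = 1) (z : K) :
    rotation B e f z e = z • e := by
  rw [rotation_apply, hB.eq f e, hef, he, mul_one, mul_zero, zero_smul, add_zero, sub_smul,
    one_smul, add_sub_cancel]

/-- `rotation B e f z f = z⁻¹ f`. [folklore] -/
theorem rotation_apply_right (hf : B f f = 0) (hef : B e f = 1) (z : K) :
    rotation B e f z f = z⁻¹ • f := by
  rw [rotation_apply, hf, hef, mul_one, mul_zero, zero_smul, add_zero, sub_smul, one_smul,
    add_sub_cancel]

/-- The rotation is the identity on `{e, f}^⊥`. [folklore] -/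
theorem rotation_apply_of_ortho (z : K) {x : V} (hex : B e x = 0) (hfx : B f x = 0) :
    rotation B e f z x = x := by
  rw [rotation_apply, hex, hfx, mul_zero, mul_zero, zero_smul, zero_smul, add_zero, add_zero]

/-- `X e = e` for the generator `X` of the pair `e, f`. [folklore] -/
theorem rotationGenerator_apply_left (hB : B.IsSymm) (he : B e e = 0) (hef : B e f = 1) :
    rotationGenerator B e f e = e := by
  rw [rotationGenerator_apply, hB.eq f e, hef, he, one_smul, zero_smul, sub_zero]

/-- `X f = -f`. [folklore] -/
theorem rotationGenerator_apply_right (hf : B f f = 0) (hef : B e f = 1) :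
    rotationGenerator B e f f = -f := by
  rw [rotationGenerator_apply, hf, hef, zero_smul, one_smul, zero_sub]

/-- `X x = 0` for `x ⊥ e, f`. [folklore] -/
theorem rotationGenerator_apply_of_ortho {x : V} (hex : B e x = 0) (hfx : B f x = 0) :
    rotationGenerator B e f x = 0 := by
  rw [rotationGenerator_apply, hex, hfx, zero_smul, zero_smul, sub_zero]

/-- **The generator is `B`-antisymmetric**: `B(X x, y) + B(x, X y) = 0` (it lies in `𝔰𝔬(V, B)`).
[folklore] -/
theorem form_rotationGenerator_add (hB : B.IsSymm) (x y : V) :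
    B (rotationGenerator B e f x) y + B x (rotationGenerator B e f y) = 0 := by
  simp only [rotationGenerator_apply, map_sub, map_smul, LinearMap.sub_apply, LinearMap.smul_apply,
    smul_eq_mul, hB.eq x e, hB.eq x f, hB.eq e y, hB.eq f y]
  ring

/-- The generator takes values in the span of `e` and `f` (so in any subspace containing them).
[folklore] -/
theorem rotationGenerator_apply_mem {U : Submodule K V} (heU : e ∈ U) (hfU : f ∈ U) (x : V) :
    rotationGenerator B e f x ∈ U := by
  rw [rotationGenerator_apply]
  exact U.sub_mem (U.smul_mem _ heU) (U.smul_mem _ hfU)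

/-- The generator kills `U^⊥` when `e, f ∈ U`. [folklore] -/
theorem rotationGenerator_apply_of_mem_orthogonal {U : Submodule K V} (heU : e ∈ U) (hfU : f ∈ U)
    {w : V} (hw : w ∈ B.orthogonal U) : rotationGenerator B e f w = 0 :=
  rotationGenerator_apply_of_ortho ((LinearMap.BilinForm.mem_orthogonal_iff.1 hw) e heU)
    ((LinearMap.BilinForm.mem_orthogonal_iff.1 hw) f hfU)

/-- Every vector splits as `x = B(f,x) e + B(e,x) f + x₀` with `x₀ ⊥ e, f`. [folklore] -/
theorem form_left_sub_sub_eq_zero (hB : B.IsSymm) (he : B e e = 0) (hf : B f f = 0)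
    (hef : B e f = 1) (x : V) :
    B e (x - B f x • e - B e x • f) = 0 ∧ B f (x - B f x • e - B e x • f) = 0 := by
  constructor
  · simp only [map_sub, map_smul, smul_eq_mul, he, hef]
    ring
  · simp only [map_sub, map_smul, smul_eq_mul, hf, hB.eq f e, hef]
    ring

/-- **A reflection of the hyperbolic plane swaps the isotropic lines**: for `w = a e + b f`
non-isotropic (`a b ≠ 0`), `τ_w e = -(b/a) f`. [folklore] -/
theorem reflection_inPlane_apply_left [NeZero (2 : K)] (hB : B.IsSymm) (he : B e e = 0)
    (hf : B f f = 0) (hef : B e f = 1) {a b : K} (hab : a * b ≠ 0) :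
    reflection B (a • e + b • f) e = -(b / a) • f := by
  have h2 : (2 : K) ≠ 0 := NeZero.ne 2
  have ha : a ≠ 0 := left_ne_zero_of_mul hab
  have hb : b ≠ 0 := right_ne_zero_of_mul hab
  have hww : B (a • e + b • f) (a • e + b • f) = 2 * a * b := by
    simp only [map_add, map_smul, LinearMap.add_apply, LinearMap.smul_apply, smul_eq_mul, he, hf,
      hef, hB.eq f e]
    ring
  have hwe : B (a • e + b • f) e = b := by
    simp only [map_add, map_smul, LinearMap.add_apply, LinearMap.smul_apply, smul_eq_mul, he,
      hB.eq f e, hef]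
    ring
  rw [reflection_apply, hww, hwe, show 2 / (2 * a * b) * b = a⁻¹ by field_simp, smul_add,
    smul_smul, smul_smul, inv_mul_cancel₀ ha, one_smul, sub_add_eq_sub_sub, sub_self, zero_sub,
    div_eq_inv_mul, neg_smul, mul_comm]

/-- Likewise `τ_w f = -(a/b) e` for `w = a e + b f`. [folklore] -/
theorem reflection_inPlane_apply_right [NeZero (2 : K)] (hB : B.IsSymm) (he : B e e = 0)
    (hf : B f f = 0) (hef : B e f = 1) {a b : K} (hab : a * b ≠ 0) :
    reflection B (a • e + b • f) f = -(a / b) • e := by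
  have h := reflection_inPlane_apply_left (e := f) (f := e) hB hf he (by rw [hB.eq f e, hef])
    (a := b) (b := a) (by rwa [mul_comm])
  rwa [add_comm] at h

/-- **The product of two reflections of a hyperbolic plane is a hyperbolic rotation**: for
non-isotropic `u = a e + b f`, `v = c e + d f` in the plane of the hyperbolic pair `e, f`,
`τ_u τ_v = rotation B e f (a d / (b c))` on all of `V` (both sides fix `{e,f}^⊥`; E. Artin,
*Geometric Algebra*, Ch. III §4: the rotations of a hyperbolic plane). [folklore] -/
theorem reflection_mul_reflection_eq_rotation [NeZero (2 : K)] (hB : B.IsSymm) (he : B e e = 0)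
    (hf : B f f = 0) (hef : B e f = 1) {a b c d : K} (hab : a * b ≠ 0) (hcd : c * d ≠ 0) :
    reflection B (a • e + b • f) * reflection B (c • e + d • f) = rotation B e f (a * d / (b * c)) := by
  have ha : a ≠ 0 := left_ne_zero_of_mul hab
  have hb : b ≠ 0 := right_ne_zero_of_mul hab
  have hc : c ≠ 0 := left_ne_zero_of_mul hcd
  have hd : d ≠ 0 := right_ne_zero_of_mul hcd
  -- values on `e`, `f` and on `{e,f}^⊥`
  have h_e : (reflection B (a • e + b • f) * reflection B (c • e + d • f)) e =
      (a * d / (b * c)) • e := by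
    rw [Module.End.mul_apply, reflection_inPlane_apply_left hB he hf hef hcd, map_smul,
      reflection_inPlane_apply_right hB he hf hef hab, smul_smul]
    congr 1
    field_simp
  have h_f : (reflection B (a • e + b • f) * reflection B (c • e + d • f)) f =
      (a * d / (b * c))⁻¹ • f := by
    rw [Module.End.mul_apply, reflection_inPlane_apply_right hB he hf hef hcd, map_smul,
      reflection_inPlane_apply_left hB he hf hef hab, smul_smul]
    congr 1
    field_simp
  have h_o : ∀ x, B e x = 0 → B f x = 0 →
      (reflection B (a • e + b • f) * reflection B (c • e + d • f)) x = x := by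
    intro x hex hfx
    have h1 : ∀ s t : K, B (s • e + t • f) x = 0 := fun s t => by
      simp only [map_add, map_smul, LinearMap.add_apply, LinearMap.smul_apply, smul_eq_mul, hex, hfx,
        mul_zero, add_zero]
    rw [Module.End.mul_apply, reflection_apply_of_ortho B (h1 c d), reflection_apply_of_ortho B (h1 a b)]
  ext x
  obtain ⟨hex₀, hfx₀⟩ := form_left_sub_sub_eq_zero hB he hf hef x
  have hx : x = B f x • e + B e x • f + (x - B f x • e - B e x • f) := by abel
  rw [hx, map_add, map_add, map_smul, map_smul, h_e, h_f, h_o _ hex₀ hfx₀, map_add, map_add,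
    map_smul, map_smul, rotation_apply_left hB he hef, rotation_apply_right hf hef,
    rotation_apply_of_ortho _ hex₀ hfx₀]

/-- A vector of the plane `span {e, f}` of a hyperbolic pair has coordinates `(B(f,x), B(e,x))`.
[folklore] -/
theorem eq_of_mem_span_pair (hB : B.IsSymm) (he : B e e = 0) (hf : B f f = 0) (hef : B e f = 1)
    {x : V} (hx : x ∈ Submodule.span K {e, f}) : x = B f x • e + B e x • f := by
  obtain ⟨s, t, rfl⟩ := Submodule.mem_span_pair.1 hx
  simp only [map_add, map_smul, smul_eq_mul, hf, he, hef, hB.eq f e, mul_zero, mul_one, add_zero,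
    zero_add]

/-- An anisotropic vector of the hyperbolic plane has both coordinates non-zero:
`B(x,x) = 2 B(f,x) B(e,x)`. [folklore] -/
theorem coord_mul_coord_ne_zero (hB : B.IsSymm) (he : B e e = 0) (hf : B f f = 0) (hef : B e f = 1)
    {x : V} (hx : x ∈ Submodule.span K {e, f}) (hxx : B x x ≠ 0) : B f x * B e x ≠ 0 := by
  intro h0
  apply hxx
  have hx' := eq_of_mem_span_pair hB he hf hef hx
  rw [hx']
  simp only [map_add, map_smul, LinearMap.add_apply, LinearMap.smul_apply, smul_eq_mul, he, hf, hef,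
    hB.eq f e]
  linear_combination (2 : K) * h0

end HyperbolicPair

/-! ### Hyperbolic pairs in a nondegenerate plane (algebraically closed field) -/

/-- **A nondegenerate plane over an algebraically closed field (`2 ≠ 0`) is hyperbolic**: if
`B(u,u) ≠ 0` and the Gram determinant of `u, v` is non-zero, there is a hyperbolic pair `e, f`
(`B(e,e) = B(f,f) = 0`, `B(e,f) = 1`) with `span {e, f} = span {u, v}` (E. Artin, *Geometric
Algebra*, Ch. III, Thm. 3.9: nonsingular isotropic planes are hyperbolic; over an algebraically
closed field every plane of dimension `2` is isotropic). Construction: orthogonalise `v` to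
`v' ⊥ u`, take `s² = -B(u,u)/B(v',v')`, `e = u + s v'`, `f = (u - s v')/(2 B(u,u))`.
[folklore] -/
theorem exists_hyperbolic_pair [IsAlgClosed K] [NeZero (2 : K)] {B : LinearMap.BilinForm K V}
    (hB : B.IsSymm) {u v : V} (hu : B u u ≠ 0) (hd : planeDiscr B u v ≠ 0) :
    ∃ e f : V, e ∈ Submodule.span K {u, v} ∧ f ∈ Submodule.span K {u, v} ∧
      B e e = 0 ∧ B f f = 0 ∧ B e f = 1 ∧
      u ∈ Submodule.span K {e, f} ∧ v ∈ Submodule.span K {e, f} := by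
  have h2 : (2 : K) ≠ 0 := NeZero.ne 2
  set q := B u u with hq
  set c := B u v / q with hc
  set v' := v - c • u with hv'
  have huv' : B u v' = 0 := by
    rw [hv', map_sub, map_smul, smul_eq_mul, hc, div_mul_cancel₀ _ hu, sub_self]
  have hv'u : B v' u = 0 := by rw [hB.eq v' u, huv']
  set q' := B v' v' with hq'
  have hq' : q' = planeDiscr B u v / q := by
    rw [hq', hv', planeDiscr]
    simp only [map_sub, map_smul, LinearMap.sub_apply, LinearMap.smul_apply, smul_eq_mul, hc,
      hB.eq v u]
    field_simp
    ring
  have hq'0 : q' ≠ 0 := by rw [hq']; exact div_ne_zero hd hu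
  obtain ⟨s, hs⟩ := IsAlgClosed.exists_eq_mul_self (-(q / q'))
  have hs0 : s ≠ 0 := by
    rintro rfl
    rw [mul_zero, neg_eq_zero, div_eq_zero_iff] at hs
    exact hs.elim hu hq'0
  have hsq : s * s * q' = -q := by rw [← hs]; field_simp
  set e := u + s • v' with he
  set f₀ := u - s • v' with hf₀
  set f := (2 * q)⁻¹ • f₀ with hf
  have hee : B e e = 0 := by
    rw [he]
    simp only [map_add, map_smul, LinearMap.add_apply, LinearMap.smul_apply, smul_eq_mul, huv', hv'u]
    linear_combination hsq
  have hf₀f₀ : B f₀ f₀ = 0 := by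
    rw [hf₀]
    simp only [map_sub, map_smul, LinearMap.sub_apply, LinearMap.smul_apply, smul_eq_mul, huv', hv'u]
    linear_combination hsq
  have hef₀ : B e f₀ = 2 * q := by
    rw [he, hf₀]
    simp only [map_add, map_sub, map_smul, LinearMap.add_apply, LinearMap.smul_apply, smul_eq_mul,
      huv', hv'u]
    linear_combination (-1 : K) * hsq
  have hff : B f f = 0 := by
    rw [hf]
    simp only [map_smul, LinearMap.smul_apply, smul_eq_mul, hf₀f₀, mul_zero]
  have hef : B e f = 1 := by
    rw [hf, map_smul, smul_eq_mul, hef₀, inv_mul_cancel₀ (mul_ne_zero h2 hu)]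
  -- memberships
  have hv'mem : v' ∈ Submodule.span K {u, v} :=
    Submodule.sub_mem _ (Submodule.subset_span (by simp))
      (Submodule.smul_mem _ _ (Submodule.subset_span (by simp)))
  have humem : u ∈ Submodule.span K {u, v} := Submodule.subset_span (by simp)
  have hemem : e ∈ Submodule.span K {u, v} :=
    Submodule.add_mem _ humem (Submodule.smul_mem _ _ hv'mem)
  have hf₀mem : f₀ ∈ Submodule.span K {u, v} :=
    Submodule.sub_mem _ humem (Submodule.smul_mem _ _ hv'mem)
  have hfmem : f ∈ Submodule.span K {u, v} := Submodule.smul_mem _ _ hf₀mem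
  have hemem' : e ∈ Submodule.span K {e, f} := Submodule.subset_span (by simp)
  have hfmem' : f ∈ Submodule.span K {e, f} := Submodule.subset_span (by simp)
  have hf₀mem' : f₀ ∈ Submodule.span K {e, f} := by
    have : f₀ = (2 * q) • f := by rw [hf, smul_smul, mul_inv_cancel₀ (mul_ne_zero h2 hu), one_smul]
    rw [this]
    exact Submodule.smul_mem _ _ hfmem'
  have humem' : u ∈ Submodule.span K {e, f} := by
    have : u = (2 : K)⁻¹ • (e + f₀) := by
      rw [he, hf₀, add_add_sub_cancel, ← two_smul K u, smul_smul, inv_mul_cancel₀ h2, one_smul]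
    rw [this]
    exact Submodule.smul_mem _ _ (Submodule.add_mem _ hemem' hf₀mem')
  have hv'mem' : v' ∈ Submodule.span K {e, f} := by
    have : v' = (2 * s)⁻¹ • (e - f₀) := by
      rw [he, hf₀, add_sub_sub_cancel, ← two_smul K (s • v'), smul_smul, smul_smul,
        show (2 * s)⁻¹ * 2 * s = 1 by field_simp, one_smul]
    rw [this]
    exact Submodule.smul_mem _ _ (Submodule.sub_mem _ hemem' hf₀mem')
  have hvmem' : v ∈ Submodule.span K {e, f} := by
    have : v = v' + c • u := by rw [hv', sub_add_cancel]
    rw [this]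
    exact Submodule.add_mem _ hv'mem' (Submodule.smul_mem _ _ humem')
  exact ⟨e, f, hemem, hfmem, hee, hff, hef, humem', hvmem'⟩

/-- The span of two vectors of `U` lies in `U`. [folklore] -/
theorem span_pair_le {U : Submodule K V} {a b : V} (ha : a ∈ U) (hb : b ∈ U) :
    Submodule.span K {a, b} ≤ U := by
  rw [Submodule.span_le]
  rintro x (rfl | rfl)
  exacts [ha, hb]

/-- **`τ_u τ_v` is a hyperbolic rotation with generator supported on `U`**: for non-isotropic
`u, v ∈ U` spanning a nondegenerate plane (algebraically closed `K`, `2 ≠ 0`), there are a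
hyperbolic pair `e, f ∈ U` and `z ≠ 0` with `τ_u τ_v = rotation B e f z`. [folklore] -/
theorem exists_reflection_mul_reflection_eq_rotation [IsAlgClosed K] [NeZero (2 : K)]
    {B : LinearMap.BilinForm K V} (hB : B.IsSymm) {U : Submodule K V} {u v : V} (huU : u ∈ U)
    (hvU : v ∈ U) (hu : B u u ≠ 0) (hv : B v v ≠ 0) (hd : planeDiscr B u v ≠ 0) :
    ∃ (e f : V) (z : K), e ∈ U ∧ f ∈ U ∧ B e e = 0 ∧ B f f = 0 ∧ B e f = 1 ∧ z ≠ 0 ∧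
      reflection B u * reflection B v = rotation B e f z := by
  obtain ⟨e, f, he, hf, hee, hff, hef, hu', hv'⟩ := exists_hyperbolic_pair hB hu hd
  have hle := span_pair_le (K := K) huU hvU
  have hab := coord_mul_coord_ne_zero hB hee hff hef hu' hu
  have hcd := coord_mul_coord_ne_zero hB hee hff hef hv' hv
  refine ⟨e, f, B f u * B e v / (B e u * B f v), hle he, hle hf, hee, hff, hef, ?_, ?_⟩
  · exact div_ne_zero (mul_ne_zero (left_ne_zero_of_mul hab) (right_ne_zero_of_mul hcd))
      (mul_ne_zero (right_ne_zero_of_mul hab) (left_ne_zero_of_mul hcd))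
  · conv_lhs => rw [eq_of_mem_span_pair hB hee hff hef hu', eq_of_mem_span_pair hB hee hff hef hv']
    exact reflection_mul_reflection_eq_rotation hB hee hff hef hab hcd

/-! ### Nondegenerate subspaces: anisotropic vectors and a generic pivot -/

/-- A non-zero subspace on which the symmetric form `B` is nondegenerate (no non-zero vector of `U`
is orthogonal to all of `U`) contains an anisotropic vector (`2 ≠ 0`: a symmetric alternating form
vanishes). [folklore] -/
theorem exists_mem_form_self_ne_zero [NeZero (2 : K)] {B : LinearMap.BilinForm K V} (hB : B.IsSymm)
    {U : Submodule K V} (hU : ∀ u ∈ U, (∀ v ∈ U, B u v = 0) → u = 0) (hne : U ≠ ⊥) :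
    ∃ x ∈ U, B x x ≠ 0 := by
  by_contra hall
  simp only [not_exists, not_and, not_not] at hall
  apply hne
  rw [Submodule.eq_bot_iff]
  intro u hu
  refine hU u hu fun v hv => ?_
  have h := hall (u + v) (U.add_mem hu hv)
  simp only [map_add, LinearMap.add_apply, hall u hu, hall v hv, zero_add, add_zero] at h
  rw [hB.eq v u, ← two_mul] at h
  exact (mul_eq_zero.1 h).resolve_left (NeZero.ne 2)

/-- Elementwise nondegeneracy of `U` from nondegeneracy of the restricted form. [folklore] -/
theorem eq_zero_of_restrict_nondegenerate {B : LinearMap.BilinForm K V} {U : Submodule K V}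
    (hU : (B.restrict U).Nondegenerate) {u : V} (hu : u ∈ U) (h : ∀ v ∈ U, B u v = 0) : u = 0 := by
  have h0 : (⟨u, hu⟩ : U) = 0 := hU.1 ⟨u, hu⟩ fun v => by
    rw [LinearMap.BilinForm.restrict_apply, LinearMap.domRestrict_apply]
    exact h v v.2
  exact congrArg Subtype.val h0

/-- In a nondegenerate subspace of dimension `≥ 2`, every anisotropic `m ∈ U` has an anisotropic
`q ∈ U` orthogonal to it (`U ∩ m^⊥` is nondegenerate and non-zero). [folklore] -/
theorem exists_orth_mem_form_self_ne_zero [NeZero (2 : K)] [FiniteDimensional K V]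
    {B : LinearMap.BilinForm K V} (hB : B.IsSymm) {U : Submodule K V}
    (hU : ∀ u ∈ U, (∀ v ∈ U, B u v = 0) → u = 0) (h2U : 2 ≤ Module.finrank K U) {m : V}
    (hm : m ∈ U) (hmm : B m m ≠ 0) : ∃ q ∈ U, B m q = 0 ∧ B q q ≠ 0 := by
  set U' : Submodule K V := U ⊓ B.orthogonal (K ∙ m) with hU'
  have hmemU' : ∀ z, z ∈ U' ↔ z ∈ U ∧ B m z = 0 := by
    intro z
    rw [hU', Submodule.mem_inf, LinearMap.BilinForm.mem_orthogonal_iff]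
    constructor
    · rintro ⟨hzU, hz⟩
      exact ⟨hzU, hz m (Submodule.mem_span_singleton_self m)⟩
    · rintro ⟨hzU, hz⟩
      refine ⟨hzU, fun x hx => ?_⟩
      obtain ⟨c, rfl⟩ := Submodule.mem_span_singleton.1 hx
      rw [map_smul, LinearMap.smul_apply, hz, smul_zero]
  have hproj : ∀ z, B m (z - (B m z / B m m) • m) = 0 := fun z => by
    rw [map_sub, map_smul, smul_eq_mul, div_mul_cancel₀ _ hmm, sub_self]
  have hU'nd : ∀ u ∈ U', (∀ v ∈ U', B u v = 0) → u = 0 := by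
    intro u hu hu'
    obtain ⟨huU, hmu⟩ := (hmemU' u).1 hu
    refine hU u huU fun v hv => ?_
    have hv' : v - (B m v / B m m) • m ∈ U' :=
      (hmemU' _).2 ⟨U.sub_mem hv (U.smul_mem _ hm), hproj v⟩
    have h := hu' _ hv'
    rw [map_sub, map_smul, smul_eq_mul, hB.eq u m, hmu, mul_zero, sub_zero] at h
    exact h
  have hne : U' ≠ ⊥ := by
    intro hbot
    have hle : U ≤ K ∙ m := by
      intro z hz
      have hz' : z - (B m z / B m m) • m ∈ U' :=
        (hmemU' _).2 ⟨U.sub_mem hz (U.smul_mem _ hm), hproj z⟩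
      rw [hbot, Submodule.mem_bot, sub_eq_zero] at hz'
      rw [hz']
      exact Submodule.smul_mem _ _ (Submodule.mem_span_singleton_self m)
    have hm0 : m ≠ 0 := fun h => hmm (by simp [h])
    have h1 : Module.finrank K U ≤ 1 :=
      (Submodule.finrank_mono hle).trans (finrank_span_singleton hm0).le
    omega
  obtain ⟨q, hqU', hqq⟩ := exists_mem_form_self_ne_zero hB hU'nd hne
  exact ⟨q, ((hmemU' q).1 hqU').1, ((hmemU' q).1 hqU').2, hqq⟩

/-- Finitely many non-zero polynomials over an infinite field have a common non-root. [folklore] -/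
theorem exists_forall_eval_ne_zero [Infinite K] (ps : List (Polynomial K)) (h : ∀ P ∈ ps, P ≠ 0) :
    ∃ t : K, ∀ P ∈ ps, P.eval t ≠ 0 := by
  classical
  obtain ⟨t, ht⟩ := Infinite.exists_notMem_finset (ps.toFinset.biUnion fun P => P.roots.toFinset)
  refine ⟨t, fun P hP h0 => ht ?_⟩
  rw [Finset.mem_biUnion]
  exact ⟨P, List.mem_toFinset.2 hP, Multiset.mem_toFinset.2 ((Polynomial.mem_roots (h P hP)).2 h0)⟩

/-- The quadratic polynomial `α + β X + γ X²`. [folklore] -/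
def quadPoly (α β γ : K) : Polynomial K :=
  Polynomial.C α + Polynomial.C β * Polynomial.X + Polynomial.C γ * Polynomial.X ^ 2

/-- Evaluation of `quadPoly`. [folklore] -/
theorem eval_quadPoly (α β γ t : K) : (quadPoly α β γ).eval t = α + β * t + γ * t ^ 2 := by
  simp [quadPoly]

/-- `quadPoly α β γ ≠ 0` if `α ≠ 0`. [folklore] -/
theorem quadPoly_ne_zero_of_left {α : K} (β γ : K) (hα : α ≠ 0) : quadPoly α β γ ≠ 0 := by
  intro h
  have h0 := congrArg (fun P : Polynomial K => P.coeff 0) h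
  simp [quadPoly] at h0
  exact hα h0

/-- `quadPoly α β γ ≠ 0` if `γ ≠ 0`. [folklore] -/
theorem quadPoly_ne_zero_of_right (α β : K) {γ : K} (hγ : γ ≠ 0) : quadPoly α β γ ≠ 0 := by
  intro h
  have h2 := congrArg (fun P : Polynomial K => P.coeff 2) h
  simp [quadPoly] at h2
  exact hγ h2

/-- The norm along the line `p₀ + t q` is the quadratic `B(p₀,p₀) + 2 B(p₀,q) t + B(q,q) t²`.
[folklore] -/
theorem form_add_smul_self {B : LinearMap.BilinForm K V} (hB : B.IsSymm) (p₀ q : V) (t : K) :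
    B (p₀ + t • q) (p₀ + t • q) = (quadPoly (B p₀ p₀) (2 * B p₀ q) (B q q)).eval t := by
  rw [eval_quadPoly]
  simp only [map_add, map_smul, LinearMap.add_apply, LinearMap.smul_apply, smul_eq_mul, hB.eq q p₀]
  ring

/-- The plane discriminant along the line `p₀ + t q` is a quadratic in `t` with constant term
`planeDiscr B n p₀` and leading coefficient `planeDiscr B n q`. [folklore] -/
theorem planeDiscr_add_smul {B : LinearMap.BilinForm K V} (hB : B.IsSymm) (n p₀ q : V) (t : K) :
    planeDiscr B n (p₀ + t • q) =
      (quadPoly (planeDiscr B n p₀) (2 * (B n n * B p₀ q - B n p₀ * B n q)) (planeDiscr B n q)).eval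
        t := by
  rw [eval_quadPoly, planeDiscr, planeDiscr, planeDiscr]
  simp only [map_add, map_smul, LinearMap.add_apply, LinearMap.smul_apply, smul_eq_mul, hB.eq q p₀]
  ring

/-- **A generic pivot.** In a nondegenerate subspace `U` of dimension `≥ 2` over an infinite field
with `2 ≠ 0`, finitely many anisotropic vectors `n ∈ S ⊆ U` admit a common anisotropic `p ∈ U` with
all Gram determinants `planeDiscr B n p ≠ 0` (the bad `p` form a finite union of proper quadrics
of `U`; induct on `S`, moving along a line `p₀ + t q` with `q ⊥` the new vector). [folklore] -/
theorem exists_forall_planeDiscr_ne_zero [Infinite K] [NeZero (2 : K)] [FiniteDimensional K V]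
    {B : LinearMap.BilinForm K V} (hB : B.IsSymm) {U : Submodule K V}
    (hU : ∀ u ∈ U, (∀ v ∈ U, B u v = 0) → u = 0) (h2U : 2 ≤ Module.finrank K U) (S : Finset V)
    (hS : ∀ n ∈ S, n ∈ U ∧ B n n ≠ 0) :
    ∃ p ∈ U, B p p ≠ 0 ∧ ∀ n ∈ S, planeDiscr B n p ≠ 0 := by
  classical
  induction S using Finset.induction_on with
  | empty =>
    have hne : U ≠ ⊥ := by
      intro h
      rw [h, finrank_bot] at h2U
      omega
    obtain ⟨p, hpU, hpp⟩ := exists_mem_form_self_ne_zero hB hU hne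
    exact ⟨p, hpU, hpp, by simp⟩
  | insert m S hmS ih =>
    obtain ⟨p₀, hp₀U, hp₀, hdisc⟩ := ih fun n hn => hS n (Finset.mem_insert_of_mem hn)
    obtain ⟨hmU, hmm⟩ := hS m (Finset.mem_insert_self m S)
    obtain ⟨q, hqU, hmq, hqq⟩ := exists_orth_mem_form_self_ne_zero hB hU h2U hmU hmm
    -- the polynomials to avoid
    set Pn : V → Polynomial K := fun n =>
      quadPoly (planeDiscr B n p₀) (2 * (B n n * B p₀ q - B n p₀ * B n q)) (planeDiscr B n q) with hPn
    set ps : List (Polynomial K) :=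
      quadPoly (B p₀ p₀) (2 * B p₀ q) (B q q) :: Pn m :: S.toList.map Pn with hps
    have hps0 : ∀ P ∈ ps, P ≠ 0 := by
      intro P hP
      simp only [hps, List.mem_cons, List.mem_map, Finset.mem_toList] at hP
      rcases hP with rfl | rfl | ⟨n, hn, rfl⟩
      · exact quadPoly_ne_zero_of_left _ _ hp₀
      · refine quadPoly_ne_zero_of_right _ _ ?_
        rw [planeDiscr, hmq, mul_zero, sub_zero]
        exact mul_ne_zero hmm hqq
      · exact quadPoly_ne_zero_of_left _ _ (hdisc n hn)
    obtain ⟨t, ht⟩ := exists_forall_eval_ne_zero ps hps0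
    refine ⟨p₀ + t • q, U.add_mem hp₀U (U.smul_mem _ hqU), ?_, ?_⟩
    · rw [form_add_smul_self hB]
      exact ht _ (by rw [hps]; exact List.mem_cons_self)
    · intro n hn
      rw [planeDiscr_add_smul hB]
      rcases Finset.mem_insert.1 hn with rfl | hn
      · exact ht (Pn n) (by rw [hps]; exact List.mem_cons_of_mem _ List.mem_cons_self)
      · exact ht (Pn n) (by
          rw [hps]
          exact List.mem_cons_of_mem _ (List.mem_cons_of_mem _
            (List.mem_map.2 ⟨n, Finset.mem_toList.2 hn, rfl⟩)))

/-! ### Main theorem: `SO` is generated by hyperbolic rotations -/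

/-- **A special orthogonal transformation supported on a nondegenerate subspace `U` is a product
of hyperbolic rotations with hyperbolic pairs in `U`.** Over an algebraically closed field of
characteristic `≠ 2`: for a nondegenerate symmetric `B` on a finite-dimensional `V`, a subspace `U`
with `B|_U` nondegenerate and `dim U ≥ 2`, and a `B`-orthogonal `σ` with `det σ = 1` which is the
identity on `U^⊥`, there are hyperbolic pairs `eᵢ, fᵢ ∈ U` and units `zᵢ` with
`σ = ∏ᵢ rotation B eᵢ fᵢ zᵢ` (Cartan–Dieudonné relative to `U`, parity `det τ = -1`, a generic
pivot `p` to write `τ_a τ_b = (τ_a τ_p)(τ_p τ_b)` with nondegenerate planes, and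
`τ_u τ_v = rotation` in a hyperbolic plane; E. Artin, *Geometric Algebra*, Ch. III, Thm. 3.20 and
§4). [folklore] -/
theorem exists_eq_prod_rotations [IsAlgClosed K] [NeZero (2 : K)] [FiniteDimensional K V]
    {B : LinearMap.BilinForm K V} (hB : B.IsSymm) (hBn : B.Nondegenerate) (U : Submodule K V)
    (hU : (B.restrict U).Nondegenerate) (h2U : 2 ≤ Module.finrank K U) (σ : Module.End K V)
    (hσ : B.IsOrthogonal σ) (hfix : ∀ w ∈ B.orthogonal U, σ w = w) (hdet : LinearMap.det σ = 1) :
    ∃ R : List (V × V × K),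
      (∀ r ∈ R, r.1 ∈ U ∧ r.2.1 ∈ U ∧ B r.1 r.1 = 0 ∧ B r.2.1 r.2.1 = 0 ∧ B r.1 r.2.1 = 1 ∧
        r.2.2 ≠ 0) ∧
      σ = (R.map fun r => rotation B r.1 r.2.1 r.2.2).prod := by
  classical
  obtain ⟨l, hl, hσl⟩ := exists_eq_prod_reflections_of_forall_mem_orthogonal hB hBn U hU σ hσ hfix
  have heven : Even l.length :=
    even_length_of_det_eq_one B (fun n hn => (hl n hn).2) (hσl ▸ hdet)
  obtain ⟨P, hP, hprod⟩ := exists_pairs_prod_eq (reflection B) l heven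
  have hUel : ∀ u ∈ U, (∀ v ∈ U, B u v = 0) → u = 0 :=
    fun u hu h => eq_zero_of_restrict_nondegenerate hU hu h
  obtain ⟨p, hpU, hpp, hdisc⟩ := exists_forall_planeDiscr_ne_zero hB hUel h2U l.toFinset
    fun n hn => hl n (List.mem_toFinset.1 hn)
  -- build the rotation word pair by pair
  have build : ∀ Q : List (V × V), (∀ q ∈ Q, q.1 ∈ l ∧ q.2 ∈ l) →
      ∃ R : List (V × V × K),
        (∀ r ∈ R, r.1 ∈ U ∧ r.2.1 ∈ U ∧ B r.1 r.1 = 0 ∧ B r.2.1 r.2.1 = 0 ∧ B r.1 r.2.1 = 1 ∧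
          r.2.2 ≠ 0) ∧
        (Q.map fun q => reflection B q.1 * reflection B q.2).prod =
          (R.map fun r => rotation B r.1 r.2.1 r.2.2).prod := by
    intro Q
    induction Q with
    | nil => intro _; exact ⟨[], by simp, by simp⟩
    | cons q Q ih =>
      intro hQ
      obtain ⟨R', hR', hprod'⟩ := ih fun q' hq' => hQ q' (List.mem_cons_of_mem q hq')
      obtain ⟨haU, haa⟩ := hl q.1 (hQ q List.mem_cons_self).1
      obtain ⟨hbU, hbb⟩ := hl q.2 (hQ q List.mem_cons_self).2
      have hda : planeDiscr B q.1 p ≠ 0 := hdisc q.1 (List.mem_toFinset.2 (hQ q List.mem_cons_self).1)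
      have hdb : planeDiscr B p q.2 ≠ 0 := by
        rw [planeDiscr_comm hB]
        exact hdisc q.2 (List.mem_toFinset.2 (hQ q List.mem_cons_self).2)
      obtain ⟨e₁, f₁, z₁, he₁, hf₁, he₁e₁, hf₁f₁, he₁f₁, hz₁, h₁⟩ :=
        exists_reflection_mul_reflection_eq_rotation hB haU hpU haa hpp hda
      obtain ⟨e₂, f₂, z₂, he₂, hf₂, he₂e₂, hf₂f₂, he₂f₂, hz₂, h₂⟩ :=
        exists_reflection_mul_reflection_eq_rotation hB hpU hbU hpp hbb hdb
      refine ⟨(e₁, f₁, z₁) :: (e₂, f₂, z₂) :: R', ?_, ?_⟩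
      · intro r hr
        rcases List.mem_cons.1 hr with rfl | hr
        · exact ⟨he₁, hf₁, he₁e₁, hf₁f₁, he₁f₁, hz₁⟩
        rcases List.mem_cons.1 hr with rfl | hr
        · exact ⟨he₂, hf₂, he₂e₂, hf₂f₂, he₂f₂, hz₂⟩
        · exact hR' r hr
      · rw [List.map_cons, List.prod_cons, hprod', List.map_cons, List.map_cons, List.prod_cons,
          List.prod_cons, ← mul_assoc, ← h₁, ← h₂]
        -- `τ_a τ_b = (τ_a τ_p)(τ_p τ_b)`
        rw [show reflection B q.1 * reflection B p * (reflection B p * reflection B q.2) =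
            reflection B q.1 * reflection B q.2 by
          rw [mul_assoc, ← mul_assoc (reflection B p), reflection_mul_self, one_mul], mul_assoc]
  obtain ⟨R, hR, hprodR⟩ := build P hP
  exact ⟨R, hR, by rw [hσl, hprod, hprodR]⟩

end OrthogonalGeneration

end Literature.AlgebraicGeometry.Motives

end
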